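import Mathlib
import HarnessLib
import Summits.HubbardSuperconductivity.HubbardSuperconductivity.Theorems.KLProgrammeKLRegimeEngineScaleZeroKernelNormsWtPackage
import Summits.HubbardSuperconductivity.HubbardSuperconductivity.Theorems.KLProgrammeKLRegimeEngineCutoffKernelNormsWtAt
import Summits.HubbardSuperconductivity.HubbardSuperconductivity.Theorems.KLProgrammeKLRegimeEngineScaleOneAlphaW
import Summits.HubbardSuperconductivity.HubbardSuperconductivity.Theorems.KLProgrammeKLRegimeEngineScaleOneTheta

/-!
# KL programme — K3 VL child (stmt-HubbardSuperconductivity-23356), atom `stub_vl_HE1free`, LEVEL 0 («(VL)-HE1-LEVEL0», F7): the weighted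
# profile of `𝒱_1 @ F_0` PACKAGED — `klWtPinnedSumAt … 0 0 m (klEffectiveAction … K klE0 1) q w ≤ N m` under the binders of the scale-`0`
# engine package, ONE CALL (twin of p3 g8's `…ScaleZeroKernelNormsWtPackage.kernelNormsWt_zero_of_bounds` at the cutoff `Λ₁ = e₀/4`)

Cell gate-hubbard-kl, seat p3 (g20); VL lead k3c4-p1 g18 (HE1-GRANULARITY-g18.md §2″: the level-`0` datum of HE1free = the scale-0 ONE-STEP
lane at cutoff `Λ₁`; also the INPUT profile `hN` of block 0's partial steps from `J₁ = 1`).  Inputs composed here by name: the sharp Gram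
`κ₁ = √(2(7+6047)) + √6047` (`isGramBoundedR_scaleOneCutoff_of_frameOK_sharp`), the weighted grid rows (α_w)₁ `≤ 4M·Ā/β`
(`rowSum/colSum_scaleOne_gridLabelWt_le`, `Ā` any bound of the `Λ₁` bracket `A0₁ + uvTimeMomentConst Λ₁ 7 32 + 2X_R,₁(B,U,n_β)`), the
smallness `θ_w ≤ 1/2` (`thetaW_cutoff_le_half` from `16e⁵Āk̄K ≤ 1`, `64e⁹κ₁²Ā|U| ≤ 1`), the `E(F_0)·S` overlap rows from the torus sums
`T_w = (M/β)(2·klIsoT + C_T + X)` EXACTLY as at `e₀` (isotropy `klIsoT` via `TorusFourierL2.exists_isoTorusBoundAt`, the time part `hCT` and the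
space part `hTX` as hypotheses of the same shape as p4 g9's `engineFirstMoments_zero_of_bounds`), and the cutoff-generic door
`klWtPinnedSumAt_klEffectiveAction_le_of_wgridStep (n := 1)`:

* **`kernelNormsWtAt_one_of_bounds`** — under `P.WF`, `R.WF2`, `0 < c ≤ klEngC₃3 P R`, `μ ∈ klWindowC`, `0 < U ≤ klEngU₀3 P R c`,
  `klBetaMin ≤ β ≤ e^{c/U²}`, `FrameOK R U (nScales β) μ K`, `klEngL₃ β U ≤ L`, `klEngM₃ β U L ≤ M`, cutoff derivatives `≤ B` (`1 ≤ B`), the `Ā`/`k̄K`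
  bounds and the two smallness conditions: for every budget `N` with `N 2 ≥ 2t²(e⁵k̄K + 4e⁹κ₁²|U|)`,
  `N (2p) ≥ 2^p·4e⁹κ₁⁴κ₁^{-2p}t^{2p}(16e⁹κ₁²Ā|U|)^{p-2}|U|` (`p ≥ 2`), `N odd ≥ 0` (`t = 2klIsoT + C_T + X`):
  `∀ m q w, klWtPinnedSumAt L M β μ K 0 0 m (klEffectiveAction L M β U μ K klE0 1) q w ≤ N m`.

Degree 2 carries the counterterm's weighted moment `k̄K`; degrees `≥ 4` are `U^{p-1}`-shaped — the law units E1 threads into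
`C₀·klWtBudget P Q₁ U 1 (2p)`.  Everything is proved; no definitions, no named facts, no sorry.  [cite: BenfattoGiulianiMastropietro2006, §2.7 (2.77)–(2.81), §3 (3.2)–(3.8)]
-/

noncomputable section

namespace Summit.HubbardSuperconductivity.HubbardSuperconductivity.Theorems.EngineV8

set_option linter.dupNamespace false -- summit = problem name (single-conjunct summit), D-0017

open Real Finset Complex Literature.MathematicalPhysics.QuantumLattice Literature.Probability.LatticeModels Literature.Probability.LatticeModels.BattleFederbush Literature.MathematicalPhysics.QuantumLattice.GrassmannAlgebra
open Summit.HubbardSuperconductivity.HubbardSuperconductivity.Theorems.KLRegimeSplit Summit.HubbardSuperconductivity.HubbardSuperconductivity.Theorems.DispersionFlow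
open Summit.HubbardSuperconductivity.HubbardSuperconductivity.Theorems.KLProgrammeLegKernels Summit.HubbardSuperconductivity.HubbardSuperconductivity.Theorems.ScaleZeroDecay
open scoped ComplexConjugate

variable {L M : ℕ}

/-- **The weighted profile of `𝒱_1[K] @ F_0` under the scale-`0` package binders, at the cutoff `Λ₁ = e₀/4`** (twin of
`kernelNormsWt_zero_of_bounds`; `κ₁ = √(2(7+6047)) + √6047`, `t = 2klIsoT + C_T + X`). [cite: BenfattoGiulianiMastropietro2006, §2.7 (2.77)–(2.81)] -/
theorem kernelNormsWtAt_one_of_bounds {C_T : ℝ} (hCT0 : 0 ≤ C_T)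
    (hCT : ∀ (L M : ℕ) [NeZero L] [NeZero M] (R : RenConsts) (U : ℝ) (N : ℕ) (μ : ℝ) (K : TrigPolyC4v),
      FrameOK R U N μ K → (∀ j, 0 ≤ R.Gfr j) → μ ∈ klWindowC → 16 / 15 * (R.Gfr 0 * |U|) ≤ 1 / 50 → (2 : ℝ) ^ 15 ≤ L →
      ∀ β : ℝ, klBetaMin ≤ β → β ≤ M → klE0 * β ≤ Real.pi * (2 * M - 13) →
      ∀ (ω : Fin (sectorCount 0)) (c : Fin 2),
        1 / (|β| * (L : ℝ) ^ 2) *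
            ∑ dw : TorusSite 1 (2 * (2 * M)) × TorusSite 2 L,
              (β / (2 * (2 * M) : ℕ) * cyclicDist (2 * (2 * M)) (dw.1 0) 0) *
                ‖∑ k : FreqMomentum L M, klAnisoFamily L M β μ K klE0 0 ω k *
                  (if c = 0 then torusChar (fun _ : Fin 1 => ((k.1 : ℕ) : ZMod (2 * (2 * M)))) dw.1 * torusChar k.2 dw.2 else conj (torusChar (fun _ : Fin 1 => ((k.1 : ℕ) : ZMod (2 * (2 * M)))) dw.1 * torusChar k.2 dw.2))‖ ≤
          C_T * (M / β))
    {X : ℝ} (hX0 : 0 ≤ X)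
    (P : SplitConsts) (R : RenConsts) (c : ℝ) (hP : P.WF) (hR : R.WF2) (hc : 0 < c) (hc₃ : c ≤ klEngC₃3 P R)
    (μ : ℝ) (hμ : μ ∈ klWindowC) (U : ℝ) (hU : 0 < U) (hU₀ : U ≤ klEngU₀3 P R c) (β : ℝ) (hβ : klBetaMin ≤ β)
    (hβc : β ≤ Real.exp (c / U ^ 2)) (K : TrigPolyC4v) (hK : FrameOK R U (nScales β) μ K) (L M : ℕ) [NeZero L] [NeZero M]
    (hL : klEngL₃ β U ≤ L) (hM : klEngM₃ β U L ≤ M)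
    {B : ℝ} (hB1 : 1 ≤ B) (hB : ∀ i ≤ 5, ∀ t, ‖iteratedDeriv i salmhoferCutoff t‖ ≤ B)
    {Abar : ℝ}
    (hAbar : (14 * Real.sqrt ((1 / 2 + 12 / klScale klE0 1) *
            (2 / klScale klE0 1 + 128 * Real.pi ^ 4 * (4 * (1110 : ℝ) + 6 * (32 / 3) + 2) ^ 2 / klScale klE0 1 +
              2 * Real.pi ^ 5 * (4 * (1110 : ℝ) + 6 * (32 / 3) + 2) ^ 2 / klScale klE0 1 ^ 2 + 1 +
              Real.pi ^ 4 * ((7 : ℝ) ^ 2 * (4 * (1110 : ℝ) + 6 * (32 / 3) + 2) * (2 / klScale klE0 1) + 7 * (2 * (32 / 3) + 1)) ^ 2 /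
                klScale klE0 1 ^ 3))) + uvTimeMomentConst (klScale klE0 1) 7 32 +
        2 * (uvSpaceMomentConst (klScale klE0 1) 1 (uvPieceSq (klScale klE0 1) (uvBaseQ B (klScale klE0 1) 4) (uvBaseQ' B (klScale klE0 1) 4)) +
          (1 / 4 * Real.sqrt (216 * (1 / klScale klE0 1 + 1 / 2)) *
              ∑ e : Fin 2 × Fin 2, (uvLinV (klScale klE0 1) (1 + (e.1 : ℕ) + (e.2 : ℕ)) *
                  (B * ((1 + ((e.1 : ℕ) + (e.2 : ℕ)) + 2).factorial : ℝ) * (4 / klScale klE0 1) ^ (1 + ((e.1 : ℕ) + (e.2 : ℕ)) + 1)) +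
                uvLinD (klScale klE0 1) (1 + (e.1 : ℕ) + (e.2 : ℕ)) *
                  (B * ((1 + ((e.1 : ℕ) + (e.2 : ℕ)) + 3).factorial : ℝ) * (4 / klScale klE0 1) ^ (1 + ((e.1 : ℕ) + (e.2 : ℕ)) + 2)))) *
            (4608 * (1 + R.Gfr 0 + R.Gfr 1 + R.Gfr 2 + R.Gfr 3) ^ 4 * ((((nScales β : ℕ) : ℝ) + 1) * U ^ 2 + 2 * |U|))) ≤ Abar)
    {kKbar : ℝ}
    (hkKbar : klKappaFrameC R * |U| + 2 * ((((nScales β : ℕ) : ℝ) + 1) * U ^ 2 *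
        (6 * (Real.pi * R.Gfr 1 / 2 + Real.pi ^ 2 * R.Gfr 2 / (2 * Real.sqrt 2) + Real.pi ^ 3 * R.Gfr 3 / 8))) ≤ kKbar)
    (hθ1 : 16 * Real.exp 1 ^ 5 * Abar * kKbar ≤ 1) (hθ2 : 64 * Real.exp 1 ^ 9 * (Real.sqrt (2 * (7 + 6047)) + Real.sqrt 6047) ^ 2 * Abar * |U| ≤ 1)
    (hTX : ∀ (ω : Fin (sectorCount 0)) (c' : Fin 2), 1 / (|β| * (L : ℝ) ^ 2) *
        ∑ dw : TorusSite 1 (2 * (2 * M)) × TorusSite 2 L, (torusSiteDist dw.2 0 : ℝ) *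
            ‖∑ k : FreqMomentum L M, klAnisoFamily L M β μ K klE0 0 ω k *
              (if c' = 0 then torusChar (fun _ : Fin 1 => ((k.1 : ℕ) : ZMod (2 * (2 * M)))) dw.1 * torusChar k.2 dw.2 else conj (torusChar (fun _ : Fin 1 => ((k.1 : ℕ) : ZMod (2 * (2 * M)))) dw.1 * torusChar k.2 dw.2))‖ ≤ X * (M / β))
    (N : ℕ → ℝ) (hNodd : ∀ m, Odd m → 0 ≤ N m)
    (hN2 : 2 * (2 * klIsoT + C_T + X) ^ 2 *
        (Real.exp 1 ^ 5 * kKbar + 4 * Real.exp 1 ^ 9 * (Real.sqrt (2 * (7 + 6047)) + Real.sqrt 6047) ^ 2 * |U|) ≤ N 2)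
    (hNp : ∀ p, 2 ≤ p → 2 ^ p * (4 * Real.exp 1 ^ 9 * (Real.sqrt (2 * (7 + 6047)) + Real.sqrt 6047) ^ 4 * ((Real.sqrt (2 * (7 + 6047)) + Real.sqrt 6047))⁻¹ ^ (2 * p) *
        (2 * klIsoT + C_T + X) ^ (2 * p) * (16 * Real.exp 1 ^ 9 * (Real.sqrt (2 * (7 + 6047)) + Real.sqrt 6047) ^ 2 * Abar * |U|) ^ (p - 2) * |U|) ≤
          N (2 * p)) :
    ∀ (m : ℕ) (q : Fin m) (w : SpaceTimeIdx L M × SectorLeg (sectorCount 0)),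
      klWtPinnedSumAt L M β μ K 0 0 m (klEffectiveAction L M β U μ K klE0 1) q w ≤ N m := by

  classical
  haveI : NeZero (2 * (2 * M)) := ⟨by have := NeZero.ne M; omega⟩
  have hRwf : R.WF := hR.wf
  have hGfr : ∀ j, 0 ≤ R.Gfr j := hRwf.2.2
  have hβ0 : 0 < β := beta_pos_of_klBetaMin_le hβ
  have hβ128 : (128 : ℝ) ≤ β := by simpa [klBetaMin] using hβ
  obtain ⟨hL15, hβL, hM2, hβM, hβ3M, hMβ3⟩ := scaleZero_regime_sizes hβ hL hM
  have hMpos : (0 : ℝ) < M := by linarith only [hβ128, hβM]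
  have hLpos : (0 : ℝ) < L := by linarith only [hβ128, hβL]
  have hU1 : |U| ≤ 1 := abs_le_one_of_le_klEngU₀3 hU hU₀
  have hUabs : |U| = U := abs_of_pos hU
  have hκU : 16 / 15 * (R.Gfr 0 * |U|) ≤ 1 / 50 := gfr0_abs_mul_le_of_le_klEngU₀3 hU hU₀
  have hMβ13 : klE0 * β ≤ Real.pi * (2 * M - 13) := by
    have hE : klE0 = 1 / 32 := by norm_num [klE0]
    rw [hE]
    have hβ3 : (128 : ℝ) ^ 2 * β ≤ β ^ 3 := by
      have h1 : 0 ≤ β * (β - 128) * (β + 128) := by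
        have := sub_nonneg.2 hβ128
        positivity
      nlinarith only [h1]
    have h2 : β ≤ 2 * (M : ℝ) - 13 := by linarith only [hβ3, hβ3M, hβ128]
    have h3 : (1 : ℝ) / 32 * β ≤ 3 * (2 * (M : ℝ) - 13) := by linarith only [h2, hβ128]
    have h4 : 3 * (2 * (M : ℝ) - 13) ≤ Real.pi * (2 * M - 13) :=
      mul_le_mul_of_nonneg_right Real.pi_gt_three.le (by linarith only [h2, hβ128])
    exact h3.trans h4
  have hN4 : (((2 * (2 * M) : ℕ) : ℝ)) = 4 * M := by push_cast; ring
  have hN0 : 0 < (((2 * (2 * M) : ℕ) : ℝ)) := by rw [hN4]; positivity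
  have hMN : 2 * M ≤ 2 * (2 * M) := by omega
  have hκ0 : 0 < (Real.sqrt (2 * (7 + 6047)) + Real.sqrt 6047) :=
    add_pos_of_pos_of_nonneg (Real.sqrt_pos.2 (by norm_num)) (Real.sqrt_nonneg _)
  have hΛ1 : (0 : ℝ) < klScale klE0 1 := by norm_num [klE0, klScale]
  have hA0pos : 0 < (14 * Real.sqrt ((1 / 2 + 12 / klScale klE0 1) *
            (2 / klScale klE0 1 + 128 * Real.pi ^ 4 * (4 * (1110 : ℝ) + 6 * (32 / 3) + 2) ^ 2 / klScale klE0 1 +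
              2 * Real.pi ^ 5 * (4 * (1110 : ℝ) + 6 * (32 / 3) + 2) ^ 2 / klScale klE0 1 ^ 2 + 1 +
              Real.pi ^ 4 * ((7 : ℝ) ^ 2 * (4 * (1110 : ℝ) + 6 * (32 / 3) + 2) * (2 / klScale klE0 1) + 7 * (2 * (32 / 3) + 1)) ^ 2 /
                klScale klE0 1 ^ 3))) := by positivity
  have hGB := isGramBoundedR_scaleOneCutoff_of_frameOK_sharp (L := L) (M := M) hK hβ hβL
  have hAXnn : 0 ≤ uvTimeMomentConst (klScale klE0 1) 7 32 := by
    have := timeMoment_scaleOne_of_frameOK (L := L) hK hβ hβ3M hMN 0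
    refine le_trans ?_ this
    exact mul_nonneg (div_nonneg hβ0.le (Nat.cast_nonneg _)) (Finset.sum_nonneg fun a _ => Finset.sum_nonneg fun bv _ =>
      mul_nonneg (mul_nonneg (div_nonneg hβ0.le (Nat.cast_nonneg _)) (abs_nonneg _)) (norm_nonneg _))
  have hAbar0 : 0 < Abar := by
    refine lt_of_lt_of_le ?_ hAbar
    have hsp := spaceMoment_scaleOne_of_frameOK (L := L) (M := M) (N := 2 * (2 * M)) hK hRwf hU1 hβ hβ3M hMN hB1 hB
      (l := 0) (l' := 1) (by decide) 0
    have hsp0 : 0 ≤ β / (((2 * (2 * M) : ℕ) : ℝ)) * ∑ a : TorusSite 1 (2 * (2 * M)), ∑ bv : TorusSite 2 L,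
        |(((bv 0).valMinAbs : ℤ) : ℝ)| * ‖∑ q₀ : TorusSite 1 (2 * (2 * M)), ∑ qv : TorusSite 2 L, torusChar q₀ a * torusChar qv bv *
          gridSymbol L M (2 * (2 * M)) β (uvSymbolCT L M β μ K (klScale klE0 1)) 0 q₀ qv‖ :=
      mul_nonneg (div_nonneg hβ0.le (Nat.cast_nonneg _)) (Finset.sum_nonneg fun a _ => Finset.sum_nonneg fun bv _ =>
        mul_nonneg (abs_nonneg _) (norm_nonneg _))
    have hAT := hAXnn
    linarith only [hsp0.trans hsp, hAT, hA0pos]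
  have hAw : 0 < 4 * M * Abar / β := by positivity
  have hrow : ∀ X : GridLeg (GridPoint L (2 * (2 * M))), ∑ Y : GridLeg (GridPoint L (2 * (2 * M))),
      ‖((hubbardGridSub L M β (2 * (2 * M))).transpose * hubbardCovAboveCT L M β μ 0 K (klScale klE0 1) *
          hubbardGridSub L M β (2 * (2 * M))) X Y‖ * gridLabelWt L (2 * (2 * M)) β {gridLegPos X, gridLegPos Y} ≤ 4 * M * Abar / β := by
    intro X
    refine (rowSum_scaleOne_gridLabelWt_le (L := L) (M := M) hK hRwf hU1 hβ hL hM hB1 hB X).trans ?_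
    rw [hN4]
    have : (4 : ℝ) * M / β * _ ≤ 4 * M / β * Abar := mul_le_mul_of_nonneg_left hAbar (by positivity)
    calc _ ≤ 4 * M / β * Abar := this
      _ = 4 * M * Abar / β := by ring
  have hcol : ∀ Y : GridLeg (GridPoint L (2 * (2 * M))), ∑ X : GridLeg (GridPoint L (2 * (2 * M))),
      ‖((hubbardGridSub L M β (2 * (2 * M))).transpose * hubbardCovAboveCT L M β μ 0 K (klScale klE0 1) *
          hubbardGridSub L M β (2 * (2 * M))) X Y‖ * gridLabelWt L (2 * (2 * M)) β {gridLegPos X, gridLegPos Y} ≤ 4 * M * Abar / β := by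
    intro Y
    refine (colSum_scaleOne_gridLabelWt_le (L := L) (M := M) hK hRwf hU1 hβ hL hM hB1 hB Y).trans ?_
    rw [hN4]
    have : (4 : ℝ) * M / β * _ ≤ 4 * M / β * Abar := mul_le_mul_of_nonneg_left hAbar (by positivity)
    calc _ ≤ 4 * M / β * Abar := this
      _ = 4 * M * Abar / β := by ring
  have hkK : ∑ z : TorusSite 2 L, ‖framePosKernel L K z‖ * (1 + torusSiteDist z 0) ≤ kKbar :=
    (frameKernel_weightedL1_le (L := L) hRwf hU.ne' hU1 hK).trans hkKbar
  have hθ := thetaW_cutoff_le_half (L := L) (M := M) hβ0 hκ0 K hAbar0.le hkK hθ1 hθ2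
  obtain ⟨T₀, hT₀0, hT₀⟩ := TorusFourierL2.exists_isoTorusBoundAt
  have hIso := isoTorusBoundAt_klIsoT hT₀0 hT₀
  have hTw0 : 0 ≤ M / β * (2 * klIsoT + C_T + X) := by
    have := klIsoT_nonneg
    positivity
  have hT : ∀ (ω : Fin (sectorCount 0)) (c' : Fin 2), 1 / (|β| * (L : ℝ) ^ 2) *
      ∑ dw : TorusSite 1 (2 * (2 * M)) × TorusSite 2 L,
        (1 + (β / (2 * (2 * M) : ℕ) * cyclicDist (2 * (2 * M)) (dw.1 0) 0 + torusSiteDist dw.2 0)) *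
          ‖∑ k : FreqMomentum L M, klAnisoFamily L M β μ K klE0 0 ω k *
            (if c' = 0 then torusChar (fun _ : Fin 1 => ((k.1 : ℕ) : ZMod (2 * (2 * M)))) dw.1 * torusChar k.2 dw.2 else conj (torusChar (fun _ : Fin 1 => ((k.1 : ℕ) : ZMod (2 * (2 * M)))) dw.1 * torusChar k.2 dw.2))‖ ≤
      M / β * (2 * klIsoT + C_T + X) := by
    intro ω c'
    set g : TorusSite 1 (2 * (2 * M)) × TorusSite 2 L → ℝ := fun dw =>
      ‖∑ k : FreqMomentum L M, klAnisoFamily L M β μ K klE0 0 ω k *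
        (if c' = 0 then torusChar (fun _ : Fin 1 => ((k.1 : ℕ) : ZMod (2 * (2 * M)))) dw.1 * torusChar k.2 dw.2 else conj (torusChar (fun _ : Fin 1 => ((k.1 : ℕ) : ZMod (2 * (2 * M)))) dw.1 * torusChar k.2 dw.2))‖ with hg
    have hg0 : ∀ dw, 0 ≤ g dw := fun dw => norm_nonneg _
    have hpre : 0 ≤ 1 / (|β| * (L : ℝ) ^ 2) := by positivity
    have hplain : 1 / (|β| * (L : ℝ) ^ 2) * ∑ dw : TorusSite 1 (2 * (2 * M)) × TorusSite 2 L, g dw ≤ klIsoT * (2 * M / β) := by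
      have h := hIso P R c hP hR hc hc₃ μ hμ U hU hU₀ β hβ hβc K hK L M hL hM 0 ω c'
      have hw : klIsoT / imagTimeWeight β M = klIsoT * (2 * M / β) := by
        rw [imagTimeWeight]; field_simp
      rw [hw] at h
      exact h
    have htime : 1 / (|β| * (L : ℝ) ^ 2) * ∑ dw : TorusSite 1 (2 * (2 * M)) × TorusSite 2 L,
        (β / (2 * (2 * M) : ℕ) * cyclicDist (2 * (2 * M)) (dw.1 0) 0) * g dw ≤ C_T * (M / β) :=
      hCT L M R U (nScales β) μ K hK hGfr hμ hκU hL15 β hβ hβM hMβ13 ω c'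
    have hspace : 1 / (|β| * (L : ℝ) ^ 2) * ∑ dw : TorusSite 1 (2 * (2 * M)) × TorusSite 2 L,
        (torusSiteDist dw.2 0 : ℝ) * g dw ≤ X * (M / β) := hTX ω c'
    have hsplit : ∑ dw : TorusSite 1 (2 * (2 * M)) × TorusSite 2 L,
        (1 + (β / (2 * (2 * M) : ℕ) * cyclicDist (2 * (2 * M)) (dw.1 0) 0 + torusSiteDist dw.2 0)) * g dw =
        ∑ dw : TorusSite 1 (2 * (2 * M)) × TorusSite 2 L, g dw +
          ∑ dw : TorusSite 1 (2 * (2 * M)) × TorusSite 2 L, (β / (2 * (2 * M) : ℕ) * cyclicDist (2 * (2 * M)) (dw.1 0) 0) * g dw +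
          ∑ dw : TorusSite 1 (2 * (2 * M)) × TorusSite 2 L, (torusSiteDist dw.2 0 : ℝ) * g dw := by
      rw [← Finset.sum_add_distrib, ← Finset.sum_add_distrib]
      exact Finset.sum_congr rfl fun dw _ => by ring
    rw [hsplit, mul_add, mul_add]
    have : klIsoT * (2 * M / β) + C_T * (M / β) + X * (M / β) = M / β * (2 * klIsoT + C_T + X) := by ring
    linarith only [hplain, htime, hspace, this]

  set φ : TorusSite 1 (2 * (2 * M)) → TorusSite 2 L → ℝ := fun a bv =>
    1 + (β / (2 * (2 * M) : ℕ) * cyclicDist (2 * (2 * M)) (a 0) 0 + torusSiteDist bv 0) with hφ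
  have hφ0 : ∀ a bv, 0 ≤ φ a bv := fun a bv => scaleZeroMomentWeight_nonneg hβ0.le a bv
  have hrow' : ∀ X'' : SpaceTimeIdx L M × SectorLeg (sectorCount 0), ∑ X' : GridLeg (GridPoint L (2 * (2 * M))),
      ‖(sectorAnalysisMatrix L M β (klAnisoFamily L M β μ K klE0 0) * hubbardGridSub L M β (2 * (2 * M))) X'' X'‖ *
        gridLabelWt L (2 * (2 * M)) β {latticeLegPos (2 * (2 * M)) X'', gridLegPos X'} ≤ M / β * (2 * klIsoT + C_T + X) := by
    rintro ⟨y, ⟨⟨ω, σ⟩, c⟩⟩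
    have hzero : ∀ X' : GridLeg (GridPoint L (2 * (2 * M))), (X'.1.2 ≠ σ ∨ X'.2 ≠ c) →
        (sectorAnalysisMatrix L M β (klAnisoFamily L M β μ K klE0 0) * hubbardGridSub L M β (2 * (2 * M))) (y, ((ω, σ), c)) X' = 0 := by
      intro X' h
      rw [sectorAnalysis_mul_hubbardGridSub_apply, if_neg]
      rintro ⟨h2, h3⟩
      rcases h with h | h
      · exact h h2
      · exact h h3
    calc ∑ X' : GridLeg (GridPoint L (2 * (2 * M))),
          ‖(sectorAnalysisMatrix L M β (klAnisoFamily L M β μ K klE0 0) * hubbardGridSub L M β (2 * (2 * M))) (y, ((ω, σ), c)) X'‖ *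
            gridLabelWt L (2 * (2 * M)) β {latticeLegPos (2 * (2 * M)) (y, ((ω, σ), c)), gridLegPos X'}
        = ∑ q : GridPoint L (2 * (2 * M)),
          ‖(sectorAnalysisMatrix L M β (klAnisoFamily L M β μ K klE0 0) * hubbardGridSub L M β (2 * (2 * M))) (y, ((ω, σ), c)) ((q, σ), c)‖ *
            φ (fun _ : Fin 1 => ((q.1 : ℕ) : ZMod (2 * (2 * M))) - 2 * ((y.1 : ℕ) : ZMod (2 * (2 * M)))) (q.2 - y.2) := by
          rw [Fintype.sum_prod_type, Fintype.sum_prod_type]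
          refine sum_congr rfl fun q _ => ?_
          rw [Fintype.sum_eq_single σ fun σ' hσ' => ?_, Fintype.sum_eq_single c fun c' hc' => ?_]
          · rw [gridLabelWt_pair_latticeLegPos_gridLegPos hβ0.le]
          · rw [hzero ((q, σ), c') (Or.inr hc'), norm_zero, zero_mul]
          · exact sum_eq_zero fun c' _ => by rw [hzero ((q, σ'), c') (Or.inl hσ'), norm_zero, zero_mul]
      _ ≤ M / β * (2 * klIsoT + C_T + X) := rowSum_mul_sectorAnalysis_mul_hubbardGridSub_le_of_weight hβ0.ne' _ φ hT ω σ c y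
  have hcol' : ∀ X' : GridLeg (GridPoint L (2 * (2 * M))), ∑ X'' : SpaceTimeIdx L M × SectorLeg (sectorCount 0),
      ‖(sectorAnalysisMatrix L M β (klAnisoFamily L M β μ K klE0 0) * hubbardGridSub L M β (2 * (2 * M))) X'' X'‖ *
        gridLabelWt L (2 * (2 * M)) β {latticeLegPos (2 * (2 * M)) X'', gridLegPos X'} ≤ (sectorCount 0 : ℕ) * (M / β * (2 * klIsoT + C_T + X)) := by
    rintro ⟨⟨q, σ⟩, c⟩
    have hzero : ∀ X'' : SpaceTimeIdx L M × SectorLeg (sectorCount 0), (X''.2.1.2 ≠ σ ∨ X''.2.2 ≠ c) →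
        (sectorAnalysisMatrix L M β (klAnisoFamily L M β μ K klE0 0) * hubbardGridSub L M β (2 * (2 * M))) X'' ((q, σ), c) = 0 := by
      intro X'' h
      rw [sectorAnalysis_mul_hubbardGridSub_apply, if_neg]
      rintro ⟨h2, h3⟩
      rcases h with h | h
      · exact h h2.symm
      · exact h h3.symm
    calc ∑ X'' : SpaceTimeIdx L M × SectorLeg (sectorCount 0),
          ‖(sectorAnalysisMatrix L M β (klAnisoFamily L M β μ K klE0 0) * hubbardGridSub L M β (2 * (2 * M))) X'' ((q, σ), c)‖ *
            gridLabelWt L (2 * (2 * M)) β {latticeLegPos (2 * (2 * M)) X'', gridLegPos ((q, σ), c)}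
        = ∑ ω : Fin (sectorCount 0), ∑ y : SpaceTimeIdx L M,
          ‖(sectorAnalysisMatrix L M β (klAnisoFamily L M β μ K klE0 0) * hubbardGridSub L M β (2 * (2 * M))) (y, ((ω, σ), c)) ((q, σ), c)‖ *
            φ (fun _ : Fin 1 => ((q.1 : ℕ) : ZMod (2 * (2 * M))) - 2 * ((y.1 : ℕ) : ZMod (2 * (2 * M)))) (q.2 - y.2) := by
          rw [Fintype.sum_prod_type, sum_comm, Fintype.sum_prod_type, Fintype.sum_prod_type]
          refine sum_congr rfl fun ω _ => ?_
          rw [Fintype.sum_eq_single σ fun σ' hσ' => ?_]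
          · rw [Fintype.sum_eq_single c fun c' hc' => ?_]
            · exact sum_congr rfl fun y _ => by rw [gridLabelWt_pair_latticeLegPos_gridLegPos hβ0.le]
            · exact sum_eq_zero fun y _ => by rw [hzero (y, ((ω, σ), c')) (Or.inr hc'), norm_zero, zero_mul]
          · exact sum_eq_zero fun c' _ => sum_eq_zero fun y _ => by rw [hzero (y, ((ω, σ'), c')) (Or.inl hσ'), norm_zero, zero_mul]
      _ ≤ (sectorCount 0 : ℕ) * (M / β * (2 * klIsoT + C_T + X)) := colSum_mul_sectorAnalysis_mul_hubbardGridSub_le_of_weight hβ0.ne' _ φ hφ0 hT σ c q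

  have hsc : ((sectorCount 0 : ℕ) : ℝ) = 2 := by norm_num [sectorCount]
  set t := 2 * klIsoT + C_T + X with ht
  have ht0 : 0 ≤ t := by have := klIsoT_nonneg; positivity
  have hkKbar0 : 0 ≤ kKbar := by
    have h0 : 0 ≤ ∑ z : TorusSite 2 L, ‖framePosKernel L K z‖ * (1 + torusSiteDist z 0) :=
      Finset.sum_nonneg fun z _ => mul_nonneg (norm_nonneg _)
        (by have : (0 : ℝ) ≤ torusSiteDist z 0 := Nat.cast_nonneg _; linarith)
    exact h0.trans hkK
  set κ₀ := (Real.sqrt (2 * (7 + 6047)) + Real.sqrt 6047) with hκ₀def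
  have hθv1 : 1 / 2 ≤ 1 - Real.exp 1 * (4 * M * Abar / β) *
        normV (GridLeg (GridPoint L (2 * (2 * M)))) κ₀ κ₀
          ((fun m' : ℕ => if m' = 1 then |β| / (2 * (2 * M) : ℕ) * ∑ z : TorusSite 2 L, ‖framePosKernel L K z‖ * (1 + torusSiteDist z 0) else if m' = 2 then |U| * |β| / (2 * (2 * M) : ℕ) else 0)) / κ₀ ^ 2 := by
    linarith only [hθ]
  have hε : imagTimeWeight β M = β / (2 * M) := rfl
  have hε0 : 0 ≤ imagTimeWeight β M := imagTimeWeight_nonneg hβ0.le M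
  have he2 : Real.exp 2 = Real.exp 1 ^ 2 := by rw [← Real.exp_nat_mul]; norm_num
  have hκne : κ₀ ≠ 0 := hκ0.ne'
  have hβne : β ≠ 0 := hβ0.ne'
  have hMne : (M : ℝ) ≠ 0 := hMpos.ne'
  have hnV : normV (GridLeg (GridPoint L (2 * (2 * M)))) κ₀ κ₀
          ((fun m' : ℕ => if m' = 1 then |β| / (2 * (2 * M) : ℕ) * ∑ z : TorusSite 2 L, ‖framePosKernel L K z‖ * (1 + torusSiteDist z 0) else if m' = 2 then |U| * |β| / (2 * (2 * M) : ℕ) else 0)) =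
      (Real.exp 2 * (κ₀ + κ₀)) ^ 2 *
          (|β| / (2 * (2 * M) : ℕ) * ∑ z : TorusSite 2 L, ‖framePosKernel L K z‖ * (1 + torusSiteDist z 0)) +
        (Real.exp 2 * (κ₀ + κ₀)) ^ 4 * (|U| * |β| / (2 * (2 * M) : ℕ)) :=
    normV_scaleZeroPinnedL1_eq (four_le_card_gridLeg (L := L) (Ng := 2 * (2 * M))) _ _ β U _ (2 * (2 * M))
  have hnVle : normV (GridLeg (GridPoint L (2 * (2 * M)))) κ₀ κ₀
          ((fun m' : ℕ => if m' = 1 then |β| / (2 * (2 * M) : ℕ) * ∑ z : TorusSite 2 L, ‖framePosKernel L K z‖ * (1 + torusSiteDist z 0) else if m' = 2 then |U| * |β| / (2 * (2 * M) : ℕ) else 0)) ≤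
      ((Real.exp 2 * (κ₀ + κ₀)) ^ 2 * (|β| / (2 * (2 * M) : ℕ) * kKbar) + (Real.exp 2 * (κ₀ + κ₀)) ^ 4 * (|U| * |β| / (2 * (2 * M) : ℕ))) := by
    rw [hnV]
    have h1 : |β| / (2 * (2 * M) : ℕ) * (∑ z : TorusSite 2 L, ‖framePosKernel L K z‖ * (1 + torusSiteDist z 0)) ≤
        |β| / (2 * (2 * M) : ℕ) * kKbar := mul_le_mul_of_nonneg_left hkK (by positivity)
    nlinarith only [h1, sq_nonneg (Real.exp 2 * (κ₀ + κ₀))]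
  refine klWtPinnedSumAt_klEffectiveAction_le_of_wgridStep (L := L) (M := M) hβ0 U μ K 1 hκ0 hGB hAw hrow hcol hκ0
    (lt_of_le_of_lt hθ (by norm_num)) (by positivity) hrow' hcol' N hNodd ?_ ?_
  · -- degree 2: `ε·T_w·(2T_w)·κ₀⁻²·e·normV/(1-θ_w) ≤ 2t²(e⁵k̄K + 4e⁹κ₀²|U|)`
    refine le_trans ?_ hN2
    rw [hsc, show (2 : ℕ) - 1 = 1 from rfl, pow_one, pow_one]
    have hnum0 : 0 ≤ κ₀⁻¹ ^ 2 * (Real.exp 1 * ((Real.exp 2 * (κ₀ + κ₀)) ^ 2 * (|β| / (2 * (2 * M) : ℕ) * kKbar) + (Real.exp 2 * (κ₀ + κ₀)) ^ 4 * (|U| * |β| / (2 * (2 * M) : ℕ)))) := by positivity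
    calc imagTimeWeight β M * (M / β * t * (2 * (M / β * t)) * (κ₀⁻¹ ^ 2 * (Real.exp 1 *
            normV (GridLeg (GridPoint L (2 * (2 * M)))) κ₀ κ₀
          ((fun m' : ℕ => if m' = 1 then |β| / (2 * (2 * M) : ℕ) * ∑ z : TorusSite 2 L, ‖framePosKernel L K z‖ * (1 + torusSiteDist z 0) else if m' = 2 then |U| * |β| / (2 * (2 * M) : ℕ) else 0))) /
          (1 - Real.exp 1 * (4 * M * Abar / β) *
        normV (GridLeg (GridPoint L (2 * (2 * M)))) κ₀ κ₀
          ((fun m' : ℕ => if m' = 1 then |β| / (2 * (2 * M) : ℕ) * ∑ z : TorusSite 2 L, ‖framePosKernel L K z‖ * (1 + torusSiteDist z 0) else if m' = 2 then |U| * |β| / (2 * (2 * M) : ℕ) else 0)) / κ₀ ^ 2)))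
        ≤ imagTimeWeight β M * (M / β * t * (2 * (M / β * t)) * (κ₀⁻¹ ^ 2 * (Real.exp 1 * ((Real.exp 2 * (κ₀ + κ₀)) ^ 2 * (|β| / (2 * (2 * M) : ℕ) * kKbar) + (Real.exp 2 * (κ₀ + κ₀)) ^ 4 * (|U| * |β| / (2 * (2 * M) : ℕ)))) / (1 / 2))) := by
          refine mul_le_mul_of_nonneg_left (mul_le_mul_of_nonneg_left ?_ (by positivity)) hε0
          exact div_le_div₀ hnum0 (mul_le_mul_of_nonneg_left (mul_le_mul_of_nonneg_left hnVle (Real.exp_pos 1).le) (by positivity))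
            (by norm_num) hθv1
      _ = 2 * t ^ 2 * (Real.exp 1 ^ 5 * kKbar + 4 * Real.exp 1 ^ 9 * κ₀ ^ 2 * |U|) := by
          rw [hε, hN4, abs_of_pos hβ0, he2]
          field_simp
          ring
  · -- degrees `2p ≥ 4`
    intro p hp
    refine le_trans ?_ (hNp p hp)
    obtain ⟨p', rfl⟩ : ∃ p', p = p' + 2 := ⟨p - 2, by omega⟩
    rw [hsc, show 2 * (p' + 2) - 1 = 2 * p' + 3 by omega, show p' + 2 - 2 = p' from rfl, show 2 * (p' + 2) = 2 * p' + 4 by omega]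
    set Q := imagTimeWeight β M ^ (2 * p' + 3) * (M / β * t * (2 * (M / β * t)) ^ (2 * p' + 3) *
        (κ₀⁻¹ ^ (2 * p' + 4) * (Real.exp 1 * ((Real.exp 2 * (κ₀ + κ₀)) ^ (2 * 2) * (|U| * |β| / (2 * (2 * M) : ℕ)))) *
          (Real.exp 1 * (4 * M * Abar / β) * ((Real.exp 2 * (κ₀ + κ₀)) ^ (2 * 2) * (|U| * |β| / (2 * (2 * M) : ℕ))) / κ₀ ^ 2) ^ p')) with hQ
    have hQ0 : 0 ≤ Q := by positivity
    have hden : (1 / 2 : ℝ) ^ (p' + 2) ≤ (1 - Real.exp 1 * (4 * M * Abar / β) *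
        normV (GridLeg (GridPoint L (2 * (2 * M)))) κ₀ κ₀
          ((fun m' : ℕ => if m' = 1 then |β| / (2 * (2 * M) : ℕ) * ∑ z : TorusSite 2 L, ‖framePosKernel L K z‖ * (1 + torusSiteDist z 0) else if m' = 2 then |U| * |β| / (2 * (2 * M) : ℕ) else 0)) / κ₀ ^ 2) ^ (p' + 2) :=
      pow_le_pow_left₀ (by norm_num) hθv1 _
    have hreassoc : imagTimeWeight β M ^ (2 * p' + 3) * (M / β * t * (2 * (M / β * t)) ^ (2 * p' + 3) *
        (κ₀⁻¹ ^ (2 * p' + 4) * (Real.exp 1 * ((Real.exp 2 * (κ₀ + κ₀)) ^ (2 * 2) * (|U| * |β| / (2 * (2 * M) : ℕ)))) *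
          (Real.exp 1 * (4 * M * Abar / β) * ((Real.exp 2 * (κ₀ + κ₀)) ^ (2 * 2) * (|U| * |β| / (2 * (2 * M) : ℕ))) / κ₀ ^ 2) ^ p' /
            (1 - Real.exp 1 * (4 * M * Abar / β) *
        normV (GridLeg (GridPoint L (2 * (2 * M)))) κ₀ κ₀
          ((fun m' : ℕ => if m' = 1 then |β| / (2 * (2 * M) : ℕ) * ∑ z : TorusSite 2 L, ‖framePosKernel L K z‖ * (1 + torusSiteDist z 0) else if m' = 2 then |U| * |β| / (2 * (2 * M) : ℕ) else 0)) / κ₀ ^ 2) ^ (p' + 2))) =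
        Q / (1 - Real.exp 1 * (4 * M * Abar / β) *
        normV (GridLeg (GridPoint L (2 * (2 * M)))) κ₀ κ₀
          ((fun m' : ℕ => if m' = 1 then |β| / (2 * (2 * M) : ℕ) * ∑ z : TorusSite 2 L, ‖framePosKernel L K z‖ * (1 + torusSiteDist z 0) else if m' = 2 then |U| * |β| / (2 * (2 * M) : ℕ) else 0)) / κ₀ ^ 2) ^ (p' + 2) := by
      rw [hQ]; ring
    rw [hreassoc]
    calc Q / (1 - Real.exp 1 * (4 * M * Abar / β) *
        normV (GridLeg (GridPoint L (2 * (2 * M)))) κ₀ κ₀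
          ((fun m' : ℕ => if m' = 1 then |β| / (2 * (2 * M) : ℕ) * ∑ z : TorusSite 2 L, ‖framePosKernel L K z‖ * (1 + torusSiteDist z 0) else if m' = 2 then |U| * |β| / (2 * (2 * M) : ℕ) else 0)) / κ₀ ^ 2) ^ (p' + 2)
        ≤ Q / (1 / 2 : ℝ) ^ (p' + 2) := div_le_div_of_nonneg_left hQ0 (by positivity) hden
      _ = 2 ^ (p' + 2) * Q := by rw [one_div, inv_pow, div_inv_eq_mul, mul_comm]
      _ = 2 ^ (p' + 2) * (4 * Real.exp 1 ^ 9 * κ₀ ^ 4 * κ₀⁻¹ ^ (2 * p' + 4) * t ^ (2 * p' + 4) *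
            (16 * Real.exp 1 ^ 9 * κ₀ ^ 2 * Abar * |U|) ^ p' * |U|) := by
          have ha : imagTimeWeight β M * (2 * (M / β * t)) = t := by rw [hε]; field_simp
          have hb : Real.exp 1 * (4 * M * Abar / β) * ((Real.exp 2 * (κ₀ + κ₀)) ^ (2 * 2) * (|U| * |β| / (2 * (2 * M) : ℕ))) / κ₀ ^ 2 =
              16 * Real.exp 1 ^ 9 * κ₀ ^ 2 * Abar * |U| := by
            rw [hN4, abs_of_pos hβ0, he2]; field_simp; ring
          have hc : M / β * t * (Real.exp 1 * ((Real.exp 2 * (κ₀ + κ₀)) ^ (2 * 2) * (|U| * |β| / (2 * (2 * M) : ℕ)))) = 4 * Real.exp 1 ^ 9 * κ₀ ^ 4 * |U| * t := by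
            rw [hN4, abs_of_pos hβ0, he2]; field_simp; ring
          have hQ' : Q = t ^ (2 * p' + 3) * (4 * Real.exp 1 ^ 9 * κ₀ ^ 4 * |U| * t) * κ₀⁻¹ ^ (2 * p' + 4) *
              (16 * Real.exp 1 ^ 9 * κ₀ ^ 2 * Abar * |U|) ^ p' := by
            calc Q = (imagTimeWeight β M * (2 * (M / β * t))) ^ (2 * p' + 3) * (M / β * t * (Real.exp 1 * ((Real.exp 2 * (κ₀ + κ₀)) ^ (2 * 2) * (|U| * |β| / (2 * (2 * M) : ℕ))))) *
                  κ₀⁻¹ ^ (2 * p' + 4) * (Real.exp 1 * (4 * M * Abar / β) * ((Real.exp 2 * (κ₀ + κ₀)) ^ (2 * 2) * (|U| * |β| / (2 * (2 * M) : ℕ))) / κ₀ ^ 2) ^ p' := by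
                    rw [hQ, mul_pow]; ring
              _ = _ := by rw [ha, hc, hb]
          rw [hQ']
          ring

end Summit.HubbardSuperconductivity.HubbardSuperconductivity.Theorems.EngineV8

end
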